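import Literature.MathematicalPhysics.QuantumLattice.LiebFluxPhaseDLS
import Literature.MathematicalPhysics.QuantumLattice.LiebFluxPhaseTheta
import Literature.MathematicalPhysics.QuantumLattice.LiebFluxPhaseSplit
import Literature.MathematicalPhysics.QuantumLattice.LiebFluxPhaseGauge
import Literature.MathematicalPhysics.QuantumLattice.LiebFluxPhaseTorus
import HarnessLib

/-!
# Lieb's reflection-positivity inequality for the Peierls–Hubbard torus

Support file for the proof of Lieb's flux-phase theorem `Lieb1994_fluxPi_torus`
(`LiebFluxPhase.lean`; E. H. Lieb, PRL **73** (1994) 2158). This file assembles the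
**Lemma (reflection positivity)** [Lieb1994, eq. (6)],

  `Z(H_L, H_R)² ≤ Z(H_L, Θ(H_L)) Z(Θ(H_R), H_R)`,

for the Peierls–Hubbard Hamiltonian `peierlsHubbard (fermionTorusGraph 2 L) T U` on the even
`L × L` torus (`L ≥ 4`) cut by the vertical plane `P` of `LiebFluxPhaseTorus.lean`, under Lieb's
gauge convention that the hopping amplitudes through the cut are real and positive
("we are at liberty to choose `Θ(l,r) = 0`, i.e., `t_{lr} = |t_{lr}| ≥ 0`, and we do so", p. 3):
`partitionFn_sq_le_reflected`. The two Hamiltonians on the right are again Peierls–Hubbard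
Hamiltonians on the torus, with the amplitude configurations `amplLL T` (left half kept, right half
replaced by `Θ(K_L) = -R(K_L)`, i.e. `t'_{R x, R y} = -t_{xy}` — Lieb's eq. (4)) and `amplRR T`.

## The proof (matrix form of Lieb's, pp. 3–4)

* `splitHom_smul_peierlsHubbard_eq`: along the splitting isomorphism `Φ` of
  `LiebFluxPhaseSplit.lean`, `Φ(-βH(T)) = A ⊗ 1 + 1 ⊗ B + Σᵢ Mᵢ ⊗ Nᵢ` with `A = -βH_L`,
  `B = -βH_R` and the cut hopping `βt Σ_{l,σ} ((c†_l P) ⊗ c_r + (P c_l) ⊗ c†_r)`, `r = R l`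
  (`crossTerm_eq` from the cut-bond geometry `FermionTorus.sum_right_adj_eq`);
* `antiConj_thetaT_M`: `Nᵢ = J_V(Mᵢ)` for `V = thetaMatrix ρ` (`LiebFluxPhaseTheta.lean`), i.e.
  the cross term is `Σ A_L ⊗ Θ(A_L)` — Lieb's cases (ii), (iii);
* `thetaT_conj_leftHamiltonian`: `V (H_L(T))‾ Vᴴ = H_R(T')` with `T' σ x y = -(T σ (R y) (R x))^*`
  — `Θ(K_L) = -R(K_L)`, `Θ(W⁰_L) = R(W⁰_L)` [Lieb1994, eq. (4) and p. 3];
* the antilinear DLS inequality `Matrix.norm_trace_exp_kroneckerSum_le_antiConj`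
  (`LiebFluxPhaseDLS.lean`) and the identification of its right side with `Z(amplLL T)`,
  `Z(amplRR T)`.

## References

* [Lieb1994] E. H. Lieb, Phys. Rev. Lett. 73 (1994) 2158, Lemma (eq. (6)) and its proof, eq. (4).
-/

noncomputable section

namespace Literature.MathematicalPhysics.QuantumLattice

open Matrix Finset HubbardWave0 JWSplit PeierlsSplit FermionTorus NormedSpace
open scoped Kronecker ComplexOrder

/-! ### Generic complements: traces and exponentials under reindexing, `J_{Vᵀ} ∘ J_V = id` -/

section Generic

variable {m n : Type*} [Fintype m] [Fintype n] [DecidableEq m] [DecidableEq n]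

omit [DecidableEq m] [DecidableEq n] in
/-- The trace is invariant under reindexing along an equivalence. [folklore] -/
theorem trace_reindex_self (e : m ≃ n) (M : Matrix m m ℂ) : (reindex e e M).trace = M.trace := by
  simp only [Matrix.trace, Matrix.diag, reindex_apply, submatrix_apply]
  exact e.symm.sum_comp (fun i => M i i)

/-- The matrix exponential commutes with reindexing along an equivalence. [folklore] -/
theorem exp_reindex_self (e : m ≃ n) (M : Matrix m m ℂ) :
    NormedSpace.exp (reindex e e M) = reindex e e (NormedSpace.exp M) :=
  open scoped Matrix.Norms.Operator in
  (NormedSpace.map_exp (reindexAlgEquiv ℂ ℂ e)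
    (reindexAlgEquiv ℂ ℂ e).toLinearMap.continuous_of_finiteDimensional M).symm

omit [Fintype m] [Fintype n] [DecidableEq m] [DecidableEq n] in
/-- `X̄̄ = X`. [folklore] -/
theorem conjTranspose_transpose_conjTranspose_transpose (X : Matrix m n ℂ) : Xᴴᵀᴴᵀ = X := by
  rw [← conjTranspose_transpose_eq_transpose_conjTranspose, transpose_transpose, conjTranspose_conjTranspose]

omit [Fintype n] [DecidableEq m] in
/-- The transpose of a unitary is unitary (left). [folklore] -/
theorem conjTranspose_transpose_mul_transpose {V : Matrix n m ℂ} (hV' : V * Vᴴ = 1) :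
    (Vᵀ)ᴴ * Vᵀ = 1 := by
  rw [conjTranspose_transpose_eq_transpose_conjTranspose, ← transpose_mul, hV', transpose_one]

omit [Fintype m] [DecidableEq n] in
/-- The transpose of a unitary is unitary (right). [folklore] -/
theorem transpose_mul_conjTranspose_transpose {V : Matrix n m ℂ} (hV : Vᴴ * V = 1) :
    Vᵀ * (Vᵀ)ᴴ = 1 := by
  rw [conjTranspose_transpose_eq_transpose_conjTranspose, ← transpose_mul, hV, transpose_one]

omit [DecidableEq n] in
/-- **`J_{Vᵀ} ∘ J_V = id`** for a unitary `V`: the second comparison system of the DLS inequality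
is obtained by undoing `Θ`. [folklore] -/
theorem antiConj_transpose_antiConj {V : Matrix n m ℂ} (hV : Vᴴ * V = 1) (X : Matrix m m ℂ) :
    antiConj Vᵀ (antiConj V X) = X := by
  rw [antiConj_def, antiConj_def, conjTranspose_mul, conjTranspose_mul, conjTranspose_conjTranspose,
    transpose_mul, transpose_mul, conjTranspose_transpose_conjTranspose_transpose, conjTranspose_transpose_eq_transpose_conjTranspose V]
  -- `Vᵀ * (Vᴴᵀ * X * Vᵀ) * Vᴴᵀ = X`
  have h1 : Vᵀ * Vᴴᵀ = 1 := by rw [← transpose_mul, hV, transpose_one]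
  calc _ = (Vᵀ * Vᴴᵀ) * X * (Vᵀ * Vᴴᵀ) := by simp only [Matrix.mul_assoc]
    _ = X := by rw [h1, Matrix.one_mul, Matrix.mul_one]

end Generic

/-! ### The entrywise conjugate of a Peierls–Hubbard Hamiltonian -/

section Conj

variable {Λ : Type*} [LinearOrder Λ] [Fintype Λ] (G : SimpleGraph Λ) [DecidableRel G.Adj]

/-- **Complex conjugation `*` of the Hamiltonian** [Lieb1994, p. 3 (third step of `Θ`)]: the
Jordan–Wigner matrices are real, so `H(T)‾ = H(T^*)`. [cite: Lieb1994, p. 3] -/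
theorem conjTranspose_transpose_peierlsHubbard (T : Fin 2 → Λ → Λ → ℂ) (U : ℝ) :
    (peierlsHubbard G T U)ᴴᵀ = peierlsHubbard G (fun σ x y => star (T σ x y)) U := by
  have hc : ∀ i : Orb Λ, (creation i)ᴴ = annihilation i := fun i => by
    rw [creation, conjTranspose_conjTranspose]
  have hK : (∑ x : Λ, ∑ y : Λ, ∑ σ : Fin 2,
      if G.Adj x y then T σ x y • (creation (orb x σ) * annihilation (orb y σ)) else
        (0 : Matrix (Finset (Orb Λ)) (Finset (Orb Λ)) ℂ))ᴴᵀ =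
      ∑ x : Λ, ∑ y : Λ, ∑ σ : Fin 2,
        if G.Adj x y then star (T σ x y) • (creation (orb x σ) * annihilation (orb y σ)) else 0 := by
    simp only [conjTranspose_sum, transpose_sum]
    refine Finset.sum_congr rfl fun x _ => Finset.sum_congr rfl fun y _ =>
      Finset.sum_congr rfl fun σ _ => ?_
    split_ifs
    · rw [conjTranspose_smul, conjTranspose_mul, annihilation_conjTranspose, hc, transpose_smul,
        transpose_mul, annihilation_transpose, creation_transpose]
    · rw [conjTranspose_zero, transpose_zero]
  have hn : ∀ (x : Λ) (σ : Fin 2),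
      (numberOp x σ - (1 / 2 : ℂ) • (1 : Matrix (Finset (Orb Λ)) (Finset (Orb Λ)) ℂ))ᴴᵀ =
        numberOp x σ - (1 / 2 : ℂ) • 1 := by
    intro x σ
    rw [conjTranspose_sub, conjTranspose_smul, conjTranspose_one, numberOp, conjTranspose_mul,
      annihilation_conjTranspose, hc, transpose_sub, transpose_smul, transpose_one, transpose_mul,
      annihilation_transpose, creation_transpose]
    norm_num
  have hW : (∑ x : Λ, (numberOp x 0 - (1 / 2 : ℂ) • (1 : Matrix (Finset (Orb Λ)) (Finset (Orb Λ)) ℂ)) *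
      (numberOp x 1 - (1 / 2 : ℂ) • 1))ᴴᵀ =
      ∑ x : Λ, (numberOp x 0 - (1 / 2 : ℂ) • 1) * (numberOp x 1 - (1 / 2 : ℂ) • 1) := by
    simp only [conjTranspose_sum, transpose_sum]
    refine Finset.sum_congr rfl fun x _ => ?_
    rw [conjTranspose_mul, transpose_mul, hn, hn]
  rw [peierlsHubbard_def, peierlsHubbard_def, conjTranspose_add, conjTranspose_neg, conjTranspose_smul,
    transpose_add, transpose_neg, transpose_smul, hK, hW, Complex.star_def, Complex.conj_ofReal]

/-- Agreement of amplitudes on adjacent pairs gives the same Hamiltonian. [folklore] -/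
theorem peierlsHubbard_congr {T T' : Fin 2 → Λ → Λ → ℂ} (h : ∀ σ x y, G.Adj x y → T σ x y = T' σ x y)
    (U : ℝ) : peierlsHubbard G T U = peierlsHubbard G T' U := by
  rw [peierlsHubbard_def, peierlsHubbard_def]
  congr 2
  refine Finset.sum_congr rfl fun x _ => Finset.sum_congr rfl fun y _ =>
    Finset.sum_congr rfl fun σ _ => ?_
  split_ifs with hxy
  · rw [h σ x y hxy]
  · rfl

end Conj

/-! ### The torus: notation -/

namespace LiebRP

/-- Equality of torus sites decided through the linear order (the instance path that the generic
lemmas over a linearly ordered site type `Λ` instantiate to; the default search on the concrete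
`FermionTorus 2 L = Lex (Fin 2 → Fin L)` would pick the computable `Lex`/`Pi` instance, a
syntactically different term, and `1 : Matrix …`, `partitionFn`, `groundEnergy` would not match).
Used as a LOCAL instance in the files of this proof. [folklore] -/
abbrev decEqTorus (L : ℕ) : DecidableEq (FermionTorus 2 L) := fun a b => LinearOrder.toDecidableEq a b

attribute [local instance] decEqTorus

variable {L : ℕ} [NeZero L]

/-- The left sites of the `L × L` torus. [cite: Lieb1994, p. 2] -/
abbrev LS (L : ℕ) : Type := {x : FermionTorus 2 L // IsLeft L x}

/-- The right sites of the `L × L` torus. [cite: Lieb1994, p. 2] -/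
abbrev RS (L : ℕ) : Type := {x : FermionTorus 2 L // ¬IsLeft L x}

/-- The orbital reflection `ρ : Orb Λ_L ≃ Orb Λ_R`, `(x, σ) ↦ (R x, σ)`. [cite: Lieb1994, p. 3] -/
def orbReflect (hL : Even L) : Orb (LS L) ≃ Orb (RS L) := Orb.mapEquiv (leftEquivRight hL)

omit [NeZero L] in
/-- `ρ (x, σ) = (R x, σ)`. [folklore] -/
theorem orbReflect_orb (hL : Even L) (a : LS L) (σ : Fin 2) :
    orbReflect hL (orb a σ) = orb (leftEquivRight hL a) σ :=
  Orb.mapEquiv_orb _ a σ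

/-- **Lieb's `Θ` for the torus**: the unitary `V : ℓ²(𝒫 Orb Λ_L) → ℓ²(𝒫 Orb Λ_R)` of
`LiebFluxPhaseTheta.lean` for the orbital reflection. [cite: Lieb1994, p. 3] -/
abbrev thetaT (hL : Even L) : Matrix (Finset (Orb (RS L))) (Finset (Orb (LS L))) ℂ :=
  thetaMatrix (orbReflect hL)

/-- The torus graph. [folklore] -/
abbrev G (L : ℕ) : SimpleGraph (FermionTorus 2 L) := fermionTorusGraph 2 L

/-! ### `Θ(H_L) = H_R(T')` -/

/-- The amplitudes of `Θ(K_L) = -R(K_L)` on the right half: `T' σ x y = -(T σ (R y) (R x))^*`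
[Lieb1994, eq. (4): `τ K(T) τ⁻¹ = K(-T^*)`, composed with `R` and `*`]. [cite: Lieb1994, eq. (4)] -/
def reflAmpl (T : Fin 2 → FermionTorus 2 L → FermionTorus 2 L → ℂ) :
    Fin 2 → FermionTorus 2 L → FermionTorus 2 L → ℂ :=
  fun σ x y => -star (T σ (reflect y) (reflect x))

omit [NeZero L] in
/-- Unfolding lemma. [folklore] -/
theorem reflAmpl_apply (T : Fin 2 → FermionTorus 2 L → FermionTorus 2 L → ℂ) (σ : Fin 2)
    (x y : FermionTorus 2 L) : reflAmpl T σ x y = -star (T σ (reflect y) (reflect x)) := rfl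

omit [NeZero L] in
/-- Conjugation by `V` of a sum. [folklore] -/
private theorem theta_conj_sum {ι : Type*} (s : Finset ι) (hL : Even L)
    (f : ι → Matrix (Finset (Orb (LS L))) (Finset (Orb (LS L))) ℂ) :
    thetaT hL * (∑ i ∈ s, f i) * (thetaT hL)ᴴ = ∑ i ∈ s, thetaT hL * f i * (thetaT hL)ᴴ := by
  rw [Matrix.mul_sum, Matrix.sum_mul]

/-- **`Θ(H_L) = H_R(T')`**: conjugating the (real-conjugated) left Hamiltonian by Lieb's `V` gives
the Peierls–Hubbard Hamiltonian of the right half with amplitudes `reflAmpl T` and the same `U`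
(`Θ(K_L) = -R(K_L)`, `Θ(W⁰_L) = R(W⁰_L)`). [cite: Lieb1994, eq. (4) and p. 3] -/
theorem thetaT_conj_leftHamiltonian (hL : Even L) (h2 : 2 ≤ L)
    (T : Fin 2 → FermionTorus 2 L → FermionTorus 2 L → ℂ) (U : ℝ) :
    thetaT hL * (leftHamiltonian (IsLeft L) (G L) T U)ᴴᵀ * (thetaT hL)ᴴ =
      rightHamiltonian (IsLeft L) (G L) (reflAmpl T) U := by
  set e := leftEquivRight (L := L) hL with he
  dsimp only [leftHamiltonian, rightHamiltonian]
  rw [conjTranspose_transpose_peierlsHubbard, peierlsHubbard_def, peierlsHubbard_def, Matrix.mul_add,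
    Matrix.add_mul, Matrix.mul_neg, Matrix.neg_mul, Matrix.mul_smul, Matrix.smul_mul]
  congr 2
  · -- hopping: `V (Σ_{a a'} [a∼a'] T̄ c†_a c_a') Vᴴ = Σ_{b b'} [b∼b'] T' c†_b c_b'`
    rw [theta_conj_sum]
    simp only [theta_conj_sum]
    -- reindex the right-hand side by `b = e a'`, `b' = e a`
    rw [← e.sum_comp]
    conv_rhs => arg 2; ext b; rw [← e.sum_comp]
    rw [Finset.sum_comm]
    refine Finset.sum_congr rfl fun a _ => Finset.sum_congr rfl fun a' _ =>
      Finset.sum_congr rfl fun σ _ => ?_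
    have hadj : (rightGraph (IsLeft L) (G L)).Adj (e a) (e a') ↔ (leftGraph (IsLeft L) (G L)).Adj a' a := by
      simp only [SimpleGraph.comap_adj, Function.Embedding.coe_subtype, he, leftEquivRight_apply]
      rw [adj_reflect_iff h2, (G L).adj_comm]
    by_cases h : (leftGraph (IsLeft L) (G L)).Adj a' a
    · rw [if_pos h, if_pos (hadj.2 h), Matrix.mul_smul, Matrix.smul_mul, thetaMatrix_conj_creation_mul_annihilation,
        if_neg (fun h' => h.ne (orb_eq_orb_iff.1 h').1), zero_sub, orbReflect_orb, orbReflect_orb, reflAmpl_apply,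
        smul_neg, neg_smul]
      simp only [he, leftEquivRight_apply, reflect_reflect]
    · rw [if_neg h, if_neg (fun h' => h (hadj.1 h')), Matrix.mul_zero, Matrix.zero_mul]
  · -- interaction
    rw [theta_conj_sum, ← e.sum_comp]
    refine Finset.sum_congr rfl fun a _ => ?_
    rw [thetaMatrix_conj_mul, show numberOp a (0 : Fin 2) = numberAt (orb a 0) from rfl,
      show numberOp a (1 : Fin 2) = numberAt (orb a 1) from rfl,
      thetaMatrix_conj_numberAt_sub_half, thetaMatrix_conj_numberAt_sub_half, orbReflect_orb,
      orbReflect_orb, neg_mul_neg]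
    rfl

/-! ### The cross term under Lieb's gauge convention -/

/-- The hopping letters through the cut, at a boundary site `a` and its mirror image:
`(c†_{aσ} P) ⊗ c_{Ra,σ} + (P c_{aσ}) ⊗ c†_{Ra,σ}`. [cite: Lieb1994, proof of the Lemma, (ii)–(iii)] -/
abbrev cutLetters (hL : Even L) (a : LS L) (σ : Fin 2) :
    Matrix (Finset (Orb (LS L)) × Finset (Orb (RS L))) (Finset (Orb (LS L)) × Finset (Orb (RS L))) ℂ :=
  hopLR (IsLeft L) a (leftEquivRight hL a) σ + hopRL (IsLeft L) a (leftEquivRight hL a) σ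

/-- **The cross term in Lieb's gauge.** If the amplitudes through the cut are the real number `t`
(both orientations), then
`crossTerm = -t Σ_{a ∈ boundary} Σ_σ ((c†_a P) ⊗ c_{Ra} + (P c_a) ⊗ c†_{Ra})`.
[cite: Lieb1994, p. 3 ("`t_{lr} = |t_{lr}| ≥ 0`")] -/
theorem crossTerm_eq (hL : Even L) (h4 : 4 ≤ L) (T : Fin 2 → FermionTorus 2 L → FermionTorus 2 L → ℂ)
    (t : ℝ) (hcut : ∀ σ x, IsBoundary L x → T σ x (reflect x) = t ∧ T σ (reflect x) x = t) :
    crossTerm (IsLeft L) (G L) T =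
      -((t : ℂ) • ∑ a : LS L, ∑ σ : Fin 2, if IsBoundary L a.1 then cutLetters hL a σ else 0) := by
  rw [crossTerm]
  have h1 : (∑ a : LS L, ∑ b : RS L, ∑ σ : Fin 2,
      if (G L).Adj a.1 b.1 then T σ a.1 b.1 • hopLR (IsLeft L) a b σ else 0) =
      ∑ a : LS L, ∑ σ : Fin 2, if IsBoundary L a.1 then (t : ℂ) • hopLR (IsLeft L) a (leftEquivRight hL a) σ else 0 := by
    refine Finset.sum_congr rfl fun a _ => ?_
    rw [Finset.sum_comm]
    refine Finset.sum_congr rfl fun σ _ => ?_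
    rw [sum_right_adj_eq hL h4 a]
    split_ifs with hb
    · rw [leftEquivRight_apply, (hcut σ a.1 hb).1]
    · rfl
  have h2 : (∑ b : RS L, ∑ a : LS L, ∑ σ : Fin 2,
      if (G L).Adj b.1 a.1 then T σ b.1 a.1 • hopRL (IsLeft L) a b σ else 0) =
      ∑ a : LS L, ∑ σ : Fin 2, if IsBoundary L a.1 then (t : ℂ) • hopRL (IsLeft L) a (leftEquivRight hL a) σ else 0 := by
    rw [Finset.sum_comm]
    refine Finset.sum_congr rfl fun a _ => ?_
    rw [Finset.sum_comm]
    refine Finset.sum_congr rfl fun σ _ => ?_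
    rw [sum_right_adj_eq' hL h4 a]
    split_ifs with hb
    · rw [leftEquivRight_apply, (hcut σ a.1 hb).2]
    · rfl
  rw [h1, h2, ← neg_add', ← Finset.sum_add_distrib, Finset.smul_sum]
  congr 1
  refine Finset.sum_congr rfl fun a _ => ?_
  rw [Finset.smul_sum, ← Finset.sum_add_distrib]
  refine Finset.sum_congr rfl fun σ _ => ?_
  split_ifs
  · rw [smul_add]
  · rw [smul_zero, add_zero]

/-! ### The DLS families `Mᵢ`, `Nᵢ` -/

/-- The index set of the cut letters: boundary site, spin, orientation. [folklore] -/
abbrev CutIdx (L : ℕ) : Type := {a : LS L // IsBoundary L a.1} × Fin 2 × Bool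

/-- The left factors `Mᵢ ∈ {√(βt) c†_{aσ} P, √(βt) P c_{aσ}}`. [cite: Lieb1994, proof of the Lemma, (ii)–(iii)] -/
def Mfam (r : ℝ) (i : CutIdx L) : Matrix (Finset (Orb (LS L))) (Finset (Orb (LS L))) ℂ :=
  bif i.2.2 then (r : ℂ) • (creation (orb i.1.1 i.2.1) * parityOp)
  else (r : ℂ) • (parityOp * annihilation (orb i.1.1 i.2.1))

/-- The right factors `Nᵢ ∈ {√(βt) c_{Ra,σ}, √(βt) c†_{Ra,σ}}`. [cite: Lieb1994, proof of the Lemma, (ii)–(iii)] -/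
def Nfam (hL : Even L) (r : ℝ) (i : CutIdx L) : Matrix (Finset (Orb (RS L))) (Finset (Orb (RS L))) ℂ :=
  bif i.2.2 then (r : ℂ) • annihilation (orb (leftEquivRight hL i.1.1) i.2.1)
  else (r : ℂ) • creation (orb (leftEquivRight hL i.1.1) i.2.1)

/-- `c†_i P` is a real matrix. [folklore] -/
theorem creation_mul_parityOp_real {ι : Type*} [LinearOrder ι] [Fintype ι] (i : ι) :
    (creation i * parityOp : Matrix (Finset ι) (Finset ι) ℂ)ᴴᵀ = creation i * parityOp :=
  conjTranspose_transpose_of_transpose_eq_conjTranspose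
    (mul_transpose_eq_conjTranspose (creation_transpose_eq_conjTranspose i) parityOp_transpose_eq_conjTranspose)

/-- `P c_i` is a real matrix. [folklore] -/
theorem parityOp_mul_annihilation_real {ι : Type*} [LinearOrder ι] [Fintype ι] (i : ι) :
    (parityOp * annihilation i : Matrix (Finset ι) (Finset ι) ℂ)ᴴᵀ = parityOp * annihilation i :=
  conjTranspose_transpose_of_transpose_eq_conjTranspose
    (mul_transpose_eq_conjTranspose parityOp_transpose_eq_conjTranspose (annihilation_transpose_eq_conjTranspose i))

omit [NeZero L] in
/-- **`Nᵢ = J_V(Mᵢ)`**: the cut hopping is a sum of terms `A_L ⊗ Θ(A_L)`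
(`θ(c_l) = c†_r`). [cite: Lieb1994, p. 3 and proof of the Lemma] -/
theorem antiConj_thetaT_Mfam (hL : Even L) (r : ℝ) (i : CutIdx L) :
    antiConj (thetaT hL) (Mfam r i) = Nfam hL r i := by
  obtain ⟨a, σ, b⟩ := i
  cases b
  · simp only [Mfam, Nfam, cond_false]
    rw [antiConj_ofReal_smul, antiConj_def, parityOp_mul_annihilation_real,
      thetaMatrix_conj_parityOp_mul_annihilation, orbReflect_orb]
  · simp only [Mfam, Nfam, cond_true]
    rw [antiConj_ofReal_smul, antiConj_def, creation_mul_parityOp_real,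
      thetaMatrix_conj_creation_mul_parityOp, orbReflect_orb]

omit [NeZero L] in
/-- **`Σᵢ Mᵢ ⊗ Nᵢ` is the cut hopping**: with `r = √(βt)`,
`Σᵢ Mᵢ ⊗ Nᵢ = βt Σ_{a ∈ boundary, σ} ((c†_a P) ⊗ c_{Ra} + (P c_a) ⊗ c†_{Ra})`. [cite: Lieb1994, proof of the Lemma] -/
theorem sum_Mfam_kronecker_Nfam (hL : Even L) {β t : ℝ} (hβt : 0 ≤ β * t) :
    ∑ i : CutIdx L, Mfam (Real.sqrt (β * t)) i ⊗ₖ Nfam hL (Real.sqrt (β * t)) i =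
      ((β * t : ℝ) : ℂ) • ∑ a : LS L, ∑ σ : Fin 2, if IsBoundary L a.1 then cutLetters hL a σ else 0 := by
  have hr : ((Real.sqrt (β * t) : ℂ)) * (Real.sqrt (β * t) : ℂ) = ((β * t : ℝ) : ℂ) := by
    rw [← Complex.ofReal_mul, Real.mul_self_sqrt hβt]
  -- the right-hand side as an indicator sum over the left sites
  have hR : ((β * t : ℝ) : ℂ) • ∑ a : LS L, ∑ σ : Fin 2, (if IsBoundary L a.1 then cutLetters hL a σ else 0) =
      ∑ a : LS L, if IsBoundary L a.1 then ∑ σ : Fin 2, ((β * t : ℝ) : ℂ) • cutLetters hL a σ else 0 := by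
    rw [Finset.smul_sum]
    refine Finset.sum_congr rfl fun a _ => ?_
    split_ifs
    · rw [Finset.smul_sum]
    · simp
  -- the left-hand side as a sum over the boundary sites
  have hLft : ∑ i : CutIdx L, Mfam (Real.sqrt (β * t)) i ⊗ₖ Nfam hL (Real.sqrt (β * t)) i =
      ∑ a' : {a : LS L // IsBoundary L a.1}, ∑ σ : Fin 2, ((β * t : ℝ) : ℂ) • cutLetters hL a'.1 σ := by
    rw [Fintype.sum_prod_type]
    refine Finset.sum_congr rfl fun a' _ => ?_
    rw [Fintype.sum_prod_type]
    refine Finset.sum_congr rfl fun σ _ => ?_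
    rw [Fintype.sum_bool]
    simp only [Mfam, Nfam, cond_true, cond_false]
    rw [smul_kronecker_smul, smul_kronecker_smul, hr, ← smul_add]
  rw [hLft, hR, ← Finset.sum_filter]
  exact (Finset.sum_subtype (univ.filter fun a : LS L => IsBoundary L a.1) (fun a => by simp)
    (fun a : LS L => ∑ σ : Fin 2, ((β * t : ℝ) : ℂ) • cutLetters hL a σ)).symm

/-! ### The decomposition of `-βH(T)` along the cut -/

/-- **Symmetrised amplitudes, left kept**: `T` on the left half and through the cut, `Θ(K_L)` on the
right half, `t'_{xy} = -(t_{R y, R x})^* = -t_{R x, R y}` for Hermitian `t`. [cite: Lieb1994, eq. (4), Theorem] -/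
def amplLL (T : Fin 2 → FermionTorus 2 L → FermionTorus 2 L → ℂ) :
    Fin 2 → FermionTorus 2 L → FermionTorus 2 L → ℂ :=
  fun σ x y => if ¬IsLeft L x ∧ ¬IsLeft L y then -star (T σ (reflect y) (reflect x)) else T σ x y

/-- **Symmetrised amplitudes, right kept**: `T` on the right half and through the cut, `Θ(K_R)` on
the left half. [cite: Lieb1994, eq. (4), Theorem] -/
def amplRR (T : Fin 2 → FermionTorus 2 L → FermionTorus 2 L → ℂ) :
    Fin 2 → FermionTorus 2 L → FermionTorus 2 L → ℂ :=
  fun σ x y => if IsLeft L x ∧ IsLeft L y then -star (T σ (reflect y) (reflect x)) else T σ x y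

omit [NeZero L] in
/-- Unfolding lemma. [folklore] -/
theorem amplLL_apply (T : Fin 2 → FermionTorus 2 L → FermionTorus 2 L → ℂ) (σ : Fin 2) (x y : FermionTorus 2 L) :
    amplLL T σ x y = if ¬IsLeft L x ∧ ¬IsLeft L y then -star (T σ (reflect y) (reflect x)) else T σ x y := rfl

omit [NeZero L] in
/-- Unfolding lemma. [folklore] -/
theorem amplRR_apply (T : Fin 2 → FermionTorus 2 L → FermionTorus 2 L → ℂ) (σ : Fin 2) (x y : FermionTorus 2 L) :
    amplRR T σ x y = if IsLeft L x ∧ IsLeft L y then -star (T σ (reflect y) (reflect x)) else T σ x y := rfl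

omit [NeZero L] in
/-- `amplLL T` is Hermitian if `T` is. [folklore] -/
theorem amplLL_herm {T : Fin 2 → FermionTorus 2 L → FermionTorus 2 L → ℂ}
    (hT : ∀ σ x y, T σ y x = star (T σ x y)) (σ : Fin 2) (x y : FermionTorus 2 L) :
    amplLL T σ y x = star (amplLL T σ x y) := by
  rw [amplLL_apply, amplLL_apply]
  by_cases h : ¬IsLeft L x ∧ ¬IsLeft L y
  · rw [if_pos ⟨h.2, h.1⟩, if_pos h, star_neg, star_star, hT, star_star]
  · rw [if_neg (fun h' => h ⟨h'.2, h'.1⟩), if_neg h, hT]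

omit [NeZero L] in
/-- `amplRR T` is Hermitian if `T` is. [folklore] -/
theorem amplRR_herm {T : Fin 2 → FermionTorus 2 L → FermionTorus 2 L → ℂ}
    (hT : ∀ σ x y, T σ y x = star (T σ x y)) (σ : Fin 2) (x y : FermionTorus 2 L) :
    amplRR T σ y x = star (amplRR T σ x y) := by
  rw [amplRR_apply, amplRR_apply]
  by_cases h : IsLeft L x ∧ IsLeft L y
  · rw [if_pos ⟨h.2, h.1⟩, if_pos h, star_neg, star_star, hT, star_star]
  · rw [if_neg (fun h' => h ⟨h'.2, h'.1⟩), if_neg h, hT]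

omit [NeZero L] in
/-- The gauge convention through the cut, both orientations, from hermiticity. [folklore] -/
theorem cut_both {T : Fin 2 → FermionTorus 2 L → FermionTorus 2 L → ℂ} {t : ℝ}
    (hT : ∀ σ x y, T σ y x = star (T σ x y)) (hcut : ∀ σ x, IsBoundary L x → T σ x (reflect x) = t)
    (σ : Fin 2) (x : FermionTorus 2 L) (hx : IsBoundary L x) : T σ x (reflect x) = t ∧ T σ (reflect x) x = t := by
  refine ⟨hcut σ x hx, ?_⟩
  rw [hT, hcut σ x hx, Complex.star_def, Complex.conj_ofReal]

omit [NeZero L] in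
/-- `amplLL T` obeys the same gauge convention through the cut. [folklore] -/
theorem cut_both_amplLL (h4 : 4 ≤ L) {T : Fin 2 → FermionTorus 2 L → FermionTorus 2 L → ℂ}
    {t : ℝ} (hT : ∀ σ x y, T σ y x = star (T σ x y)) (hcut : ∀ σ x, IsBoundary L x → T σ x (reflect x) = t)
    (σ : Fin 2) (x : FermionTorus 2 L) (hx : IsBoundary L x) :
    amplLL T σ x (reflect x) = t ∧ amplLL T σ (reflect x) x = t := by
  have hxL : IsLeft L x := hx.isLeft h4
  rw [amplLL_apply, amplLL_apply, if_neg (fun h => h.1 hxL), if_neg (fun h => h.2 hxL)]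
  exact cut_both hT hcut σ x hx

omit [NeZero L] in
/-- `amplRR T` obeys the same gauge convention through the cut. [folklore] -/
theorem cut_both_amplRR (hL : Even L) (h4 : 4 ≤ L) {T : Fin 2 → FermionTorus 2 L → FermionTorus 2 L → ℂ}
    {t : ℝ} (hT : ∀ σ x y, T σ y x = star (T σ x y)) (hcut : ∀ σ x, IsBoundary L x → T σ x (reflect x) = t)
    (σ : Fin 2) (x : FermionTorus 2 L) (hx : IsBoundary L x) :
    amplRR T σ x (reflect x) = t ∧ amplRR T σ (reflect x) x = t := by
  have hxR : ¬IsLeft L (reflect x) := hx.not_isLeft_reflect hL h4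
  rw [amplRR_apply, amplRR_apply, if_neg (fun h => hxR h.2), if_neg (fun h => hxR h.1)]
  exact cut_both hT hcut σ x hx

/-- **`Φ(-βH(T)) = A ⊗ 1 + 1 ⊗ B + Σᵢ Mᵢ ⊗ Nᵢ`** in Lieb's gauge: `A = -βH_L`, `B = -βH_R`, and the
cut hopping `-β K_int = βt Σ ((c†_l P) ⊗ c_r + (P c_l) ⊗ c†_r)`. [cite: Lieb1994, eq. (5) and proof of the Lemma] -/
theorem splitHom_neg_smul_peierlsHubbard (hL : Even L) (h4 : 4 ≤ L) {β t : ℝ} (hβt : 0 ≤ β * t) (U : ℝ)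
    (T : Fin 2 → FermionTorus 2 L → FermionTorus 2 L → ℂ)
    (hcut : ∀ σ x, IsBoundary L x → T σ x (reflect x) = t ∧ T σ (reflect x) x = t) :
    splitHom (IsLeft L) ((-(β : ℂ)) • peierlsHubbard (G L) T U) =
      ((-(β : ℂ)) • leftHamiltonian (IsLeft L) (G L) T U) ⊗ₖ (1 : Matrix (Finset (Orb (RS L))) _ ℂ) +
        (1 : Matrix (Finset (Orb (LS L))) _ ℂ) ⊗ₖ ((-(β : ℂ)) • rightHamiltonian (IsLeft L) (G L) T U) +
        ∑ i : CutIdx L, Mfam (Real.sqrt (β * t)) i ⊗ₖ Nfam hL (Real.sqrt (β * t)) i := by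
  have hs : splitHom (IsLeft L) ((-(β : ℂ)) • peierlsHubbard (G L) T U) =
      (-(β : ℂ)) • splitHom (IsLeft L) (peierlsHubbard (G L) T U) :=
    (splitHom (IsLeft L)).toLinearEquiv.map_smul _ _
  rw [hs, splitHom_peierlsHubbard, crossTerm_eq hL h4 T t hcut, sum_Mfam_kronecker_Nfam hL hβt,
    smul_add, smul_add, smul_kronecker, kronecker_smul, smul_neg, smul_smul, ← neg_smul]
  congr 2
  push_cast
  ring

/-! ### Traces of exponentials along the splitting isomorphism -/

/-- `Tr exp(Φ X) = Tr exp X` for the splitting isomorphism `Φ` (relabelling and reindexing preserve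
traces and commute with `exp`). [folklore] -/
theorem trace_exp_splitHom {Λ : Type*} [LinearOrder Λ] [Fintype Λ] (p : Λ → Prop) [DecidablePred p]
    (X : Matrix (Finset (Orb Λ)) (Finset (Orb Λ)) ℂ) :
    (NormedSpace.exp (splitHom p X)).trace = (NormedSpace.exp X).trace := by
  rw [splitHom_apply, splitAlgEquiv_apply, exp_reindex_self, trace_reindex_self, ← relabel_exp, trace_relabel]

/-- The partition function through the splitting isomorphism: `Z_β(H) = Tr exp(Φ(-βH))`. [folklore] -/
theorem partitionFn_eq_trace_exp_splitHom {Λ : Type*} [LinearOrder Λ] [Fintype Λ] (p : Λ → Prop)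
    [DecidablePred p] (β : ℝ) (H : Matrix (Finset (Orb Λ)) (Finset (Orb Λ)) ℂ) :
    H.partitionFn β = (NormedSpace.exp (splitHom p ((-(β : ℂ)) • H))).trace := by
  rw [trace_exp_splitHom, partitionFn, gibbsWeight]

/-! ### The two halves of the symmetrised Hamiltonians -/

omit [NeZero L] in
/-- `H_L(amplLL T) = H_L(T)`. [folklore] -/
theorem leftHamiltonian_amplLL (T : Fin 2 → FermionTorus 2 L → FermionTorus 2 L → ℂ) (U : ℝ) :
    leftHamiltonian (IsLeft L) (G L) (amplLL T) U = leftHamiltonian (IsLeft L) (G L) T U := by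
  dsimp only [leftHamiltonian]
  refine peierlsHubbard_congr _ (fun σ a a' _ => ?_) U
  rw [amplLL_apply, if_neg (fun h => h.1 a.2)]

omit [NeZero L] in
/-- `H_R(amplRR T) = H_R(T)`. [folklore] -/
theorem rightHamiltonian_amplRR (T : Fin 2 → FermionTorus 2 L → FermionTorus 2 L → ℂ) (U : ℝ) :
    rightHamiltonian (IsLeft L) (G L) (amplRR T) U = rightHamiltonian (IsLeft L) (G L) T U := by
  dsimp only [rightHamiltonian]
  refine peierlsHubbard_congr _ (fun σ b b' _ => ?_) U
  rw [amplRR_apply, if_neg (fun h => b.2 h.1)]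

/-- **`H_R(amplLL T) = Θ(H_L(T))`.** [cite: Lieb1994, Theorem (p. 4): "`H_L, Θ(H_L)`"] -/
theorem rightHamiltonian_amplLL (hL : Even L) (h2 : 2 ≤ L) (T : Fin 2 → FermionTorus 2 L → FermionTorus 2 L → ℂ)
    (U : ℝ) :
    rightHamiltonian (IsLeft L) (G L) (amplLL T) U =
      thetaT hL * (leftHamiltonian (IsLeft L) (G L) T U)ᴴᵀ * (thetaT hL)ᴴ := by
  rw [thetaT_conj_leftHamiltonian hL h2 T U]
  dsimp only [rightHamiltonian]
  refine peierlsHubbard_congr _ (fun σ b b' _ => ?_) U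
  rw [amplLL_apply, if_pos ⟨b.2, b'.2⟩, reflAmpl_apply]

/-- **`H_R(T) = Θ(H_L(amplRR T))`.** [cite: Lieb1994, Theorem (p. 4): "`Θ(H_R), H_R`"] -/
theorem rightHamiltonian_eq_thetaT_amplRR (hL : Even L) (h2 : 2 ≤ L)
    (T : Fin 2 → FermionTorus 2 L → FermionTorus 2 L → ℂ) (U : ℝ) :
    rightHamiltonian (IsLeft L) (G L) T U =
      thetaT hL * (leftHamiltonian (IsLeft L) (G L) (amplRR T) U)ᴴᵀ * (thetaT hL)ᴴ := by
  rw [thetaT_conj_leftHamiltonian hL h2 (amplRR T) U]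
  dsimp only [rightHamiltonian]
  refine peierlsHubbard_congr _ (fun σ b b' _ => ?_) U
  have hb : IsLeft L (reflect b.1) := (isLeft_reflect_iff hL b.1).2 b.2
  have hb' : IsLeft L (reflect b'.1) := (isLeft_reflect_iff hL b'.1).2 b'.2
  rw [reflAmpl_apply, amplRR_apply, if_pos ⟨hb', hb⟩, star_neg, star_star, neg_neg, reflect_reflect,
    reflect_reflect]

omit [NeZero L] in
/-- `-β V X̄ Vᴴ = J_V(-β X)` for real `β`. [folklore] -/
theorem neg_smul_thetaT_conj (hL : Even L) (β : ℝ) (X : Matrix (Finset (Orb (LS L))) (Finset (Orb (LS L))) ℂ) :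
    (-(β : ℂ)) • (thetaT hL * Xᴴᵀ * (thetaT hL)ᴴ) = antiConj (thetaT hL) ((-(β : ℂ)) • X) := by
  rw [antiConj_smul, antiConj_def, star_neg, Complex.star_def, Complex.conj_ofReal]

/-- **The decomposition of `-βH(amplLL T)`**: `A ⊗ 1 + 1 ⊗ J_V(A) + Σᵢ Mᵢ ⊗ J_V(Mᵢ)` — the first
comparison system of the DLS inequality. [cite: Lieb1994, Lemma, eq. (6)] -/
theorem splitHom_neg_smul_amplLL (hL : Even L) (h4 : 4 ≤ L) {β t : ℝ} (hβt : 0 ≤ β * t) (U : ℝ)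
    (T : Fin 2 → FermionTorus 2 L → FermionTorus 2 L → ℂ)
    (hT : ∀ σ x y, T σ y x = star (T σ x y)) (hcut : ∀ σ x, IsBoundary L x → T σ x (reflect x) = t) :
    splitHom (IsLeft L) ((-(β : ℂ)) • peierlsHubbard (G L) (amplLL T) U) =
      ((-(β : ℂ)) • leftHamiltonian (IsLeft L) (G L) T U) ⊗ₖ (1 : Matrix (Finset (Orb (RS L))) _ ℂ) +
        (1 : Matrix (Finset (Orb (LS L))) _ ℂ) ⊗ₖ
          antiConj (thetaT hL) ((-(β : ℂ)) • leftHamiltonian (IsLeft L) (G L) T U) +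
        ∑ i : CutIdx L, Mfam (Real.sqrt (β * t)) i ⊗ₖ antiConj (thetaT hL) (Mfam (Real.sqrt (β * t)) i) := by
  have e2 : ∑ i : CutIdx L, Mfam (Real.sqrt (β * t)) i ⊗ₖ Nfam hL (Real.sqrt (β * t)) i =
      ∑ i : CutIdx L, Mfam (Real.sqrt (β * t)) i ⊗ₖ antiConj (thetaT hL) (Mfam (Real.sqrt (β * t)) i) :=
    Finset.sum_congr rfl fun i _ => by rw [antiConj_thetaT_Mfam]
  rw [splitHom_neg_smul_peierlsHubbard hL h4 hβt U (amplLL T) (cut_both_amplLL h4 hT hcut),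
    leftHamiltonian_amplLL, rightHamiltonian_amplLL hL (by omega), neg_smul_thetaT_conj, e2]

/-- **The decomposition of `-βH(amplRR T)`**: `J_{Vᵀ}(B) ⊗ 1 + 1 ⊗ B + Σᵢ J_{Vᵀ}(Nᵢ) ⊗ Nᵢ` — the
second comparison system of the DLS inequality. [cite: Lieb1994, Lemma, eq. (6)] -/
theorem splitHom_neg_smul_amplRR (hL : Even L) (h4 : 4 ≤ L) {β t : ℝ} (hβt : 0 ≤ β * t) (U : ℝ)
    (T : Fin 2 → FermionTorus 2 L → FermionTorus 2 L → ℂ)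
    (hT : ∀ σ x y, T σ y x = star (T σ x y)) (hcut : ∀ σ x, IsBoundary L x → T σ x (reflect x) = t) :
    splitHom (IsLeft L) ((-(β : ℂ)) • peierlsHubbard (G L) (amplRR T) U) =
      antiConj (thetaT hL)ᵀ ((-(β : ℂ)) • rightHamiltonian (IsLeft L) (G L) T U) ⊗ₖ
          (1 : Matrix (Finset (Orb (RS L))) _ ℂ) +
        (1 : Matrix (Finset (Orb (LS L))) _ ℂ) ⊗ₖ ((-(β : ℂ)) • rightHamiltonian (IsLeft L) (G L) T U) +
        ∑ i : CutIdx L, antiConj (thetaT hL)ᵀ (Nfam hL (Real.sqrt (β * t)) i) ⊗ₖ Nfam hL (Real.sqrt (β * t)) i := by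
  have hV : (thetaT hL)ᴴ * thetaT hL = 1 := conjTranspose_thetaMatrix_mul_self _
  have e4 : ∑ i : CutIdx L, Mfam (Real.sqrt (β * t)) i ⊗ₖ Nfam hL (Real.sqrt (β * t)) i =
      ∑ i : CutIdx L, antiConj (thetaT hL)ᵀ (Nfam hL (Real.sqrt (β * t)) i) ⊗ₖ Nfam hL (Real.sqrt (β * t)) i :=
    Finset.sum_congr rfl fun i _ => by rw [← antiConj_thetaT_Mfam hL, antiConj_transpose_antiConj hV]
  have e3 : (-(β : ℂ)) • leftHamiltonian (IsLeft L) (G L) (amplRR T) U =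
      antiConj (thetaT hL)ᵀ ((-(β : ℂ)) • rightHamiltonian (IsLeft L) (G L) T U) := by
    rw [rightHamiltonian_eq_thetaT_amplRR hL (by omega) T U, neg_smul_thetaT_conj, antiConj_transpose_antiConj hV]
  rw [splitHom_neg_smul_peierlsHubbard hL h4 hβt U (amplRR T) (cut_both_amplRR hL h4 hT hcut),
    rightHamiltonian_amplRR, e3, e4]

/-! ### Lieb's reflection-positivity inequality -/

/-- **Lieb's Lemma (reflection positivity), eq. (6)**, for the Peierls–Hubbard Hamiltonian on the
even `L × L` torus (`L ≥ 4`, any real `U`, `β ≥ 0`, hopping amplitudes `T` Hermitian and equal to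
the real number `t ≥ 0` on the bonds through the vertical cutting plane — Lieb's gauge convention):
`Z(H_L,H_R)² ≤ Z(H_L,Θ(H_L)) · Z(Θ(H_R),H_R)`, i.e.
`Z_β(T)² ≤ Z_β(amplLL T) · Z_β(amplRR T)`. [cite: Lieb1994, Lemma, eq. (6)] -/
theorem partitionFn_sq_le_reflected (hL : Even L) (h4 : 4 ≤ L) {β t : ℝ} (hβ : 0 ≤ β) (ht : 0 ≤ t)
    (U : ℝ) (T : Fin 2 → FermionTorus 2 L → FermionTorus 2 L → ℂ)
    (hT : ∀ σ x y, T σ y x = star (T σ x y)) (hcut : ∀ σ x, IsBoundary L x → T σ x (reflect x) = t) :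
    ((peierlsHubbard (G L) T U).partitionFn β).re ^ 2 ≤
      ((peierlsHubbard (G L) (amplLL T) U).partitionFn β).re *
        ((peierlsHubbard (G L) (amplRR T) U).partitionFn β).re := by
  have hβt : 0 ≤ β * t := mul_nonneg hβ ht
  -- unitarity of `V = Θ` and of `Vᵀ`
  have hV : (thetaT hL)ᴴ * thetaT hL = 1 := conjTranspose_thetaMatrix_mul_self _
  have hV' : thetaT hL * (thetaT hL)ᴴ = 1 := thetaMatrix_mul_conjTranspose _
  have hW : ((thetaT hL)ᵀ)ᴴ * (thetaT hL)ᵀ = 1 := conjTranspose_transpose_mul_transpose hV'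
  have hW' : (thetaT hL)ᵀ * ((thetaT hL)ᵀ)ᴴ = 1 := transpose_mul_conjTranspose_transpose hV
  -- the DLS inequality for the decomposition of `-βH(T)`, read back through `Φ`
  have hDLS := Matrix.norm_trace_exp_kroneckerSum_le_antiConj
    ((-(β : ℂ)) • leftHamiltonian (IsLeft L) (G L) T U) ((-(β : ℂ)) • rightHamiltonian (IsLeft L) (G L) T U)
    (Mfam (Real.sqrt (β * t))) (Nfam hL (Real.sqrt (β * t))) hV hV' hW hW'
  rw [← splitHom_neg_smul_peierlsHubbard hL h4 hβt U T (cut_both hT hcut),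
    ← splitHom_neg_smul_amplLL hL h4 hβt U T hT hcut, ← splitHom_neg_smul_amplRR hL h4 hβt U T hT hcut,
    ← partitionFn_eq_trace_exp_splitHom, ← partitionFn_eq_trace_exp_splitHom,
    ← partitionFn_eq_trace_exp_splitHom, norm_partitionFn_peierlsHubbard (G L) T hT U β] at hDLS
  -- square it
  have hposLL := (partitionFn_peierlsHubbard_re_pos (G L) (amplLL T) (amplLL_herm hT) U β).le
  have hposRR := (partitionFn_peierlsHubbard_re_pos (G L) (amplRR T) (amplRR_herm hT) U β).le
  have hpos := (partitionFn_peierlsHubbard_re_pos (G L) T hT U β).le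
  calc ((peierlsHubbard (G L) T U).partitionFn β).re ^ 2
      ≤ (Real.sqrt ((peierlsHubbard (G L) (amplLL T) U).partitionFn β).re *
          Real.sqrt ((peierlsHubbard (G L) (amplRR T) U).partitionFn β).re) ^ 2 :=
        pow_le_pow_left₀ hpos hDLS 2
    _ = ((peierlsHubbard (G L) (amplLL T) U).partitionFn β).re *
          ((peierlsHubbard (G L) (amplRR T) U).partitionFn β).re := by
        rw [mul_pow, Real.sq_sqrt hposLL, Real.sq_sqrt hposRR]

end LiebRP



end Literature.MathematicalPhysics.QuantumLattice

end
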